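import Literature.Geometry.Lorentzian.KillingFlowIsometry
import Literature.Geometry.Lorentzian.CausalityPushUp
import HarnessLib

/-!
# The orbit relation of a chronological stationary space-time is closed
(Anderson 2000, §0: "the chronology condition implies that `S` is Hausdorff")

Let `(M, g, τ)` be a time-oriented Lorentzian manifold (Hausdorff, without boundary) carrying a
**stationary Killing field** `X` — complete, `C^n` (`n ≥ 2`), timelike and future-directed at every
point (`LorentzianMetric.IsStationaryKilling g τ X univ`, `Stationary.lean`) — with flow
`θ : ℝ × M → M` (`θ(0, p) = p`, `θ(t, θ(s, p)) = θ(t + s, p)`, `t ↦ θ(t, p)` the integral curves of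
`X`; `Literature.Geometry.Manifold.exists_contMDiff_globalFlow_of_complete`). M. T. Anderson,
*On stationary vacuum solutions to the Einstein equations*, Ann. Henri Poincaré 1 (2000), §0:
"Let `S` be the orbit space of the action `G` [`≈ ℝ`]. Then `S` is a smooth 3-manifold and the
projection `π : M → S` is a principle `ℝ`-bundle, with fiber `G`. The chronology condition implies
that `S` is Hausdorff and paracompact, c.f. [Ha]" ([Ha] = S. Harris, *Conformally stationary
spacetimes*, Class. Quantum Grav. 9 (1992) 1823–1827); and §1.1: "if `(M, g)` is not
chronological, then the orbit space `S` may not be a manifold; even if `S` is a manifold, it may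
not be Hausdorff". This file proves the Hausdorff assertion in the vocabulary of the Lorentz
prelude, where the orbit of `p` is `stationaryOrbit X {p}` (`Stationary.lean`) and no quotient type
is formed: **the orbit relation `{(p, q) | q ∈ stationaryOrbit X {p}}` is closed in `M × M`**
(`IsStationaryKilling.isClosed_setOf_mem_stationaryOrbit`), equivalently **two points on different
orbits have disjoint flow-invariant open neighbourhoods**
(`IsStationaryKilling.exists_disjoint_saturated_nhds`) — which is the Hausdorff property of the
orbit space `S = M/G` with its quotient topology (the projection being open, since the saturation
`⋃ₜ θₜ(U)` of an open set is open, `isOpen_iUnion_image_flow`).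

## The argument (made explicit; Anderson cites [Ha])

Write `x ≪ y` for `y ∈ I⁺(x)`. The ingredients are: the flow lines are future timelike, so
`θ(s, p) ≪ θ(t, p)` for `s < t` (`IsStationaryKilling.flow_mem_chronologicalFuture`); the flow
maps are time-orientation-preserving isometries, so `x ≪ y ⟺ θₜ x ≪ θₜ y`
(`KillingFlowIsometry.lean`, `IsKillingField.image_flow_chronologicalFuture`); `≪` is transitive
and open (`CausalityChronologyProofs.lean`, `CausalityOpennessProofs.lean`); and chronology forbids
`x ≪ x`. Put `U(p) = I⁺(θ₋₁ p) ∩ I⁻(θ₁ p)`, an open neighbourhood of `p`.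

* **Time rigidity** (`IsStationaryKilling.sub_le_four`). If `p' ∈ U(p)` and `θ_t p' ∈ U(q)`, then
  `q ≪ θ_{t+2} p` and `θ_{t-2} p ≪ q` (translate the four relations along the flow and compose).
  Hence two such realisations `(p₁, t₁)`, `(p₂, t₂)` give `θ_{t₂-2} p ≪ q ≪ θ_{t₁+2} p`, and if
  `t₂ - 2 > t₁ + 2` the flow line closes this to a timelike loop at `θ_{t₁+2} p`; so
  `|t₁ - t₂| ≤ 4`.
* **Closedness** (`IsStationaryKilling.isClosed_setOf_exists_flow_eq`). If `(p, q)` is in the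
  closure of the relation `R = {(x, θ_t x)}`, some `(p₁, θ_{t₁} p₁) ∈ R` lies in `U(p) × U(q)`, and
  then every element of `R` in `U(p) × U(q)` has its time in `K = [t₁ - 4, t₁ + 4]`; so `(p, q)` is
  in the closure of `R_K = {(x, θ_t x) | t ∈ K}`, which is closed (`K` compact: the projection
  `K × (M × M) → M × M` is a closed map), whence `(p, q) ∈ R_K ⊆ R`.
* **Separation** (`IsStationaryKilling.exists_disjoint_saturated_nhds`). For `q ∉ G·p`, a
  product neighbourhood `U₀ × V₀` of `(p, q)` misses `R`; the saturations `⋃ₜ θₜ(U₀)`, `⋃ₜ θₜ(V₀)`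
  are open, flow-invariant and disjoint.

Everything is proved; there are no definitions and no named facts in this file. The smooth
structure of `S` and the quotient metric `g_S` (Anderson's `(S, g_S, u, θ)`) are not constructed.

## References

* M. T. Anderson, *On stationary vacuum solutions to the Einstein equations*, Ann. Henri Poincaré 1
  (2000) 977–994, arXiv:gr-qc/0001091, §0 (orbit space, "the chronology condition implies that `S`
  is Hausdorff") and §1.1 (key `Anderson2000`).
* S. Harris, *Conformally stationary spacetimes*, Class. Quantum Grav. 9 (1992) 1823–1827
  (Anderson's reference [Ha]; not held — the argument above is supplied here).
* B. O'Neill, *Semi-Riemannian geometry*, Academic Press 1983, Ch. 9, Prop. 9.23 (flows of Killing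
  fields are isometries), Ch. 14, pp. 402–407 (`I⁺`, transitivity, chronology) (key `ONeill1983`).
-/

noncomputable section

open Bundle Set Filter Function Manifold TopologicalSpace
open scoped ContDiff Topology Manifold

namespace Literature.Geometry.Lorentzian

universe u

variable {E : Type*} [NormedAddCommGroup E] [NormedSpace ℝ E] {H : Type*} [TopologicalSpace H]
  {I : ModelWithCorners ℝ E H} {M : Type*} [TopologicalSpace M] [ChartedSpace H M]
  [IsManifold I ∞ M] {n : ℕ∞ω}

/-! ### Flows: saturations of open sets are open; orbits are flow lines -/

section FlowTopology

variable {N : Type*} [TopologicalSpace N] {θ : ℝ × N → N}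

/-- **The saturation of an open set under a flow is open**: `⋃ₜ θₜ(U)` is open for `U` open, each
`θₜ` being a homeomorphism (`isHomeomorph_flow`). This is the openness of the orbit-space projection
`π : M → S = M/G` (Anderson 2000, §0). [folklore] -/
theorem isOpen_iUnion_image_flow (hθc : Continuous θ) (hθ0 : ∀ p, θ (0, p) = p)
    (hθadd : ∀ t s p, θ (t, θ (s, p)) = θ (t + s, p)) {U : Set N} (hU : IsOpen U) :
    IsOpen (⋃ t : ℝ, (fun p ↦ θ (t, p)) '' U) :=
  isOpen_iUnion fun t ↦ (isHomeomorph_flow hθc hθ0 hθadd t).isOpenMap U hU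

end FlowTopology

section Orbit

variable [T2Space M] [BoundarylessManifold I M] {X : Π x : M, TangentSpace I x} {θ : ℝ × M → M}

/-- **Orbits are flow lines.** For a flow `θ` of the `C¹` field `X` (Hausdorff manifold without
boundary), `q` lies on the orbit of `p` iff `q = θ(t, p)` for some `t` (uniqueness of integral
curves, `eq_flow_of_isMIntegralCurve`). Anderson 2000, §0 (the orbits of `G ≈ ℝ`). [folklore] -/
theorem mem_stationaryOrbit_singleton_iff_exists_flow_eq (hX : CMDiff 1 (T% X))
    (hθX : ∀ p, IsMIntegralCurve (fun t ↦ θ (t, p)) X) (hθ0 : ∀ p, θ (0, p) = p) {p q : M} :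
    q ∈ stationaryOrbit X {p} ↔ ∃ t : ℝ, θ (t, p) = q := by
  rw [mem_stationaryOrbit_singleton_iff]
  constructor
  · rintro ⟨γ, hγ, hγ0, t, rfl⟩
    exact ⟨t, by rw [eq_flow_of_isMIntegralCurve hX hθX hθ0 hγ t, hγ0]⟩
  · rintro ⟨t, rfl⟩
    exact ⟨fun t ↦ θ (t, p), hθX p, hθ0 p, t, rfl⟩

/-- **The orbit of a set is its saturation under the flow**: `⋃ₛ φₛ(A) = ⋃ₜ θₜ(A)` for a flow `θ`
of the `C¹` field `X` (Chruściel–Costa's `M_ext = ⋃ₜ φₜ(Σ_ext)`; Anderson 2000, §0).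
[folklore] -/
theorem stationaryOrbit_eq_iUnion_image_flow (hX : CMDiff 1 (T% X))
    (hθX : ∀ p, IsMIntegralCurve (fun t ↦ θ (t, p)) X) (hθ0 : ∀ p, θ (0, p) = p) (A : Set M) :
    stationaryOrbit X A = ⋃ t : ℝ, (fun p ↦ θ (t, p)) '' A := by
  ext y
  simp only [mem_iUnion, mem_image]
  constructor
  · rintro ⟨γ, hγ, hγ0, t, rfl⟩
    exact ⟨t, γ 0, hγ0, (eq_flow_of_isMIntegralCurve hX hθX hθ0 hγ t).symm⟩
  · rintro ⟨t, a, ha, rfl⟩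
    exact ⟨fun t ↦ θ (t, a), hθX a, by simpa [hθ0] using ha, t, rfl⟩

/-- **Saturations are saturated**: the orbit of a set is a union of orbits,
`stationaryOrbit X (stationaryOrbit X A) = stationaryOrbit X A` (group law of the flow).
[folklore] -/
theorem stationaryOrbit_stationaryOrbit (hX : CMDiff 1 (T% X))
    (hθX : ∀ p, IsMIntegralCurve (fun t ↦ θ (t, p)) X) (hθ0 : ∀ p, θ (0, p) = p)
    (hθadd : ∀ t s p, θ (t, θ (s, p)) = θ (t + s, p)) (A : Set M) :
    stationaryOrbit X (stationaryOrbit X A) = stationaryOrbit X A := by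
  refine Subset.antisymm ?_ (subset_stationaryOrbit (fun x ↦ ⟨fun t ↦ θ (t, x), hθX x, hθ0 x⟩) _)
  intro y hy
  rw [stationaryOrbit_eq_iUnion_image_flow hX hθX hθ0] at hy ⊢
  simp only [mem_iUnion, mem_image] at hy ⊢
  obtain ⟨t, b, hb, rfl⟩ := hy
  rw [stationaryOrbit_eq_iUnion_image_flow hX hθX hθ0] at hb
  simp only [mem_iUnion, mem_image] at hb
  obtain ⟨s, a, ha, rfl⟩ := hb
  exact ⟨t + s, a, ha, (hθadd t s a).symm⟩

end Orbit

/-! ### Flow lines, chronology and the flow invariance of `≪` -/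

namespace LorentzianMetric

variable [FiniteDimensional ℝ E] [CompleteSpace E] [Fact (1 ≤ n)] [I.Boundaryless] [T2Space M]
  {g : LorentzianMetric I n M} [g.HasLeviCivita] {τ : TimeOrientation g}
  {X : Π x : M, TangentSpace I x} {θ : ℝ × M → M}

omit [FiniteDimensional ℝ E] [CompleteSpace E] [Fact (1 ≤ n)] [I.Boundaryless] [T2Space M] in
/-- **Flow lines are chronological**: for a stationary Killing field timelike at every point and
any flow `θ` of it, `θ(t, p) ∈ I⁺(θ(s, p))` whenever `s < t` (the flow line from `θ(s, p)` to
`θ(t, p)` is a future timelike curve, `isFutureTimelikeCurveOn_of_isMIntegralCurve`). Anderson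
2000, §0 ("orbits are time-like curves"). [cite: Anderson2000, §0] -/
theorem IsStationaryKilling.flow_mem_chronologicalFuture (h : g.IsStationaryKilling τ X univ)
    (hθX : ∀ p, IsMIntegralCurve (fun t ↦ θ (t, p)) X) {s t : ℝ} (hst : s < t) (p : M) :
    θ (t, p) ∈ g.chronologicalFuture τ {θ (s, p)} :=
  ⟨θ (s, p), rfl, fun u ↦ θ (u, p), s, t, hst,
    h.isFutureTimelikeCurveOn_of_isMIntegralCurve (hθX p) _, rfl, rfl⟩

omit [FiniteDimensional ℝ E] [CompleteSpace E] [Fact (1 ≤ n)] [I.Boundaryless] [T2Space M]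
  [g.HasLeviCivita] in
/-- **Chronology: no point is in its own chronological future** (`x ∉ I⁺(x)`): a future timelike
curve from `x` to `x` is a closed timelike curve. O'Neill 1983, Ch. 14, p. 407.
[cite: ONeill1983, Ch. 14, p. 407] -/
theorem IsChronological.not_mem_chronologicalFuture_self (hchr : g.IsChronological τ) (x : M) :
    x ∉ g.chronologicalFuture τ {x} := by
  rintro ⟨x', hx', γ, a, b, hab, hγ, ha, hb⟩
  rw [mem_singleton_iff] at hx'
  exact hchr γ a b hab hγ (ha.trans (hx'.trans hb.symm))

omit [T2Space M] in
/-- **`≪` is invariant under the flow of a Killing field, pointwise**: `θₜ y ∈ I⁺(θₜ x)` iff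
`y ∈ I⁺(x)` (`IsKillingField.image_flow_chronologicalFuture` with `A = {x}`, and injectivity of the
homeomorphism `θₜ`). O'Neill 1983, Ch. 9, Prop. 9.23 (the flow maps are isometries); Anderson
2000, §0 (`G` acts by isometries). [cite: ONeill1983, Ch. 9, Prop. 9.23] -/
theorem _root_.Literature.Geometry.Lorentzian.PseudoRiemannianMetric.IsKillingField.flow_mem_chronologicalFuture_flow_iff
    (hX : g.IsKillingField X) (hθ : ContMDiff (𝓘(ℝ, ℝ).prod I) I 2 θ) (hθ0 : ∀ p, θ (0, p) = p)
    (hθadd : ∀ t s p, θ (t, θ (s, p)) = θ (t + s, p))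
    (hθX : ∀ p, IsMIntegralCurve (fun t ↦ θ (t, p)) X) (t : ℝ) {x y : M} :
    θ (t, y) ∈ g.chronologicalFuture τ {θ (t, x)} ↔ y ∈ g.chronologicalFuture τ {x} := by
  have h := hX.image_flow_chronologicalFuture (τ := τ) hθ hθ0 hθadd hθX t {x}
  rw [image_singleton] at h
  rw [← h]
  constructor
  · rintro ⟨y', hy', hyy'⟩
    have : y' = y := (isHomeomorph_flow hθ.continuous hθ0 hθadd t).injective hyy'
    exact this ▸ hy'
  · exact fun hy ↦ mem_image_of_mem _ hy

/-! ### Time rigidity: realisations of `(p, q)` near `U(p) × U(q)` have times `4`-close -/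

omit [T2Space M] in
/-- **First translation.** If `p' ≪ θ₁ p` and `θ₋₁ q ≪ θ_t p'`, then `q ≪ θ_{t+2} p`: apply `θ₋ₜ` to
the second relation (`θ_{-t-1} q ≪ p'`), compose with the first, and apply `θ_{t+1}`. A step of the
Hausdorff argument for the orbit space (Anderson 2000, §0, citing [Ha]). [cite: Anderson2000, §0] -/
theorem IsStationaryKilling.flow_add_two_mem_chronologicalFuture (h : g.IsStationaryKilling τ X univ)
    (hθ : ContMDiff (𝓘(ℝ, ℝ).prod I) I 2 θ) (hθ0 : ∀ p, θ (0, p) = p)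
    (hθadd : ∀ t s p, θ (t, θ (s, p)) = θ (t + s, p))
    (hθX : ∀ p, IsMIntegralCurve (fun t ↦ θ (t, p)) X) {p q p' : M} {t : ℝ}
    (hp' : θ (1, p) ∈ g.chronologicalFuture τ {p'})
    (hq' : θ (t, p') ∈ g.chronologicalFuture τ {θ (-1, q)}) :
    θ (t + 2, p) ∈ g.chronologicalFuture τ {q} := by
  have hK := h.isKillingField
  have h1 := (hK.flow_mem_chronologicalFuture_flow_iff (τ := τ) hθ hθ0 hθadd hθX (-t)).2 hq'
  rw [hθadd, hθadd, neg_add_cancel, hθ0] at h1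
  -- `h1 : p' ∈ I⁺(θ(-t + -1, q))`
  have h2 : θ (1, p) ∈ g.chronologicalFuture τ {θ (-t + -1, q)} :=
    mem_chronologicalFuture_trans h1 hp'
  have h3 := (hK.flow_mem_chronologicalFuture_flow_iff (τ := τ) hθ hθ0 hθadd hθX (t + 1)).2 h2
  rw [hθadd, hθadd] at h3
  have e1 : t + 1 + 1 = t + 2 := by ring
  have e2 : t + 1 + (-t + -1) = 0 := by ring
  rwa [e1, e2, hθ0] at h3

omit [T2Space M] in
/-- **Second translation.** If `θ₋₁ p ≪ p'` and `θ_t p' ≪ θ₁ q`, then `θ_{t-2} p ≪ q`: apply `θₜ` to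
the first relation, compose with the second, and apply `θ₋₁`. (Anderson 2000, §0, citing [Ha].)
[cite: Anderson2000, §0] -/
theorem IsStationaryKilling.mem_chronologicalFuture_flow_sub_two (h : g.IsStationaryKilling τ X univ)
    (hθ : ContMDiff (𝓘(ℝ, ℝ).prod I) I 2 θ) (hθ0 : ∀ p, θ (0, p) = p)
    (hθadd : ∀ t s p, θ (t, θ (s, p)) = θ (t + s, p))
    (hθX : ∀ p, IsMIntegralCurve (fun t ↦ θ (t, p)) X) {p q p' : M} {t : ℝ}
    (hp' : p' ∈ g.chronologicalFuture τ {θ (-1, p)})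
    (hq' : θ (1, q) ∈ g.chronologicalFuture τ {θ (t, p')}) :
    q ∈ g.chronologicalFuture τ {θ (t - 2, p)} := by
  have hK := h.isKillingField
  have h1 := (hK.flow_mem_chronologicalFuture_flow_iff (τ := τ) hθ hθ0 hθadd hθX t).2 hp'
  rw [hθadd] at h1
  -- `h1 : θ(t, p') ∈ I⁺(θ(t + -1, p))`
  have h2 : θ (1, q) ∈ g.chronologicalFuture τ {θ (t + -1, p)} :=
    mem_chronologicalFuture_trans h1 hq'
  have h3 := (hK.flow_mem_chronologicalFuture_flow_iff (τ := τ) hθ hθ0 hθadd hθX (-1)).2 h2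
  rw [hθadd, hθadd, neg_add_cancel, hθ0] at h3
  have e : -1 + (t + -1) = t - 2 := by ring
  rwa [e] at h3

omit [T2Space M] in
/-- **Time rigidity.** Let `(M, g, τ)` be chronological with a stationary Killing field timelike
everywhere and flow `θ`. If `θ₁ p ≫ p₁`, `θ₋₁ q ≪ θ_{t₁} p₁` and `θ₋₁ p ≪ p₂`, `θ_{t₂} p₂ ≪ θ₁ q` —
in particular if `pᵢ ∈ U(p) = I⁺(θ₋₁ p) ∩ I⁻(θ₁ p)` and `θ_{tᵢ} pᵢ ∈ U(q)` — then `t₂ - t₁ ≤ 4`: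
otherwise `θ_{t₂-2} p ≪ q ≪ θ_{t₁+2} p ≪ θ_{t₂-2} p` (the last along the flow line) would be a
timelike loop. This is the quantitative core of "the chronology condition implies that `S` is
Hausdorff" (Anderson 2000, §0, citing [Ha]). [cite: Anderson2000, §0] -/
theorem IsStationaryKilling.sub_le_four (h : g.IsStationaryKilling τ X univ)
    (hchr : g.IsChronological τ) (hθ : ContMDiff (𝓘(ℝ, ℝ).prod I) I 2 θ)
    (hθ0 : ∀ p, θ (0, p) = p) (hθadd : ∀ t s p, θ (t, θ (s, p)) = θ (t + s, p))
    (hθX : ∀ p, IsMIntegralCurve (fun t ↦ θ (t, p)) X) {p q p₁ p₂ : M} {t₁ t₂ : ℝ}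
    (hp₁ : θ (1, p) ∈ g.chronologicalFuture τ {p₁})
    (hq₁ : θ (t₁, p₁) ∈ g.chronologicalFuture τ {θ (-1, q)})
    (hp₂ : p₂ ∈ g.chronologicalFuture τ {θ (-1, p)})
    (hq₂ : θ (1, q) ∈ g.chronologicalFuture τ {θ (t₂, p₂)}) :
    t₂ - t₁ ≤ 4 := by
  refine le_of_not_gt fun hlt ↦ ?_
  have hi := h.flow_add_two_mem_chronologicalFuture hθ hθ0 hθadd hθX hp₁ hq₁
  have hii := h.mem_chronologicalFuture_flow_sub_two hθ hθ0 hθadd hθX hp₂ hq₂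
  have h1 : θ (t₁ + 2, p) ∈ g.chronologicalFuture τ {θ (t₂ - 2, p)} :=
    mem_chronologicalFuture_trans hii hi
  have h2 : θ (t₂ - 2, p) ∈ g.chronologicalFuture τ {θ (t₁ + 2, p)} :=
    h.flow_mem_chronologicalFuture hθX (by linarith) p
  exact hchr.not_mem_chronologicalFuture_self _ (mem_chronologicalFuture_trans h2 h1)

/-! ### The orbit relation is closed -/

/-- **The flow relation `{(x, θₜ x)}` of a chronological stationary space-time is closed** in
`M × M` (Anderson 2000, §0: "The chronology condition implies that `S` is Hausdorff", citing
[Ha] = Harris 1992). Proof in the module docstring: a point `(p, q)` of the closure is approached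
through `U(p) × U(q)`, where all realising times lie in a compact interval `K` by `sub_le_four`,
and `{(x, θₜ x) | t ∈ K}` is closed because the projection along the compact factor `K` is a
closed map. [cite: Anderson2000, §0] -/
theorem IsStationaryKilling.isClosed_setOf_exists_flow_eq (h : g.IsStationaryKilling τ X univ)
    (hchr : g.IsChronological τ) (hθ : ContMDiff (𝓘(ℝ, ℝ).prod I) I 2 θ)
    (hθ0 : ∀ p, θ (0, p) = p) (hθadd : ∀ t s p, θ (t, θ (s, p)) = θ (t + s, p))
    (hθX : ∀ p, IsMIntegralCurve (fun t ↦ θ (t, p)) X) :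
    IsClosed {pq : M × M | ∃ t : ℝ, θ (t, pq.1) = pq.2} := by
  set R : Set (M × M) := {pq | ∃ t : ℝ, θ (t, pq.1) = pq.2} with hR
  refine isClosed_of_closure_subset ?_
  rintro ⟨p, q⟩ hpq
  -- the neighbourhoods `U(x) = I⁺(θ₋₁ x) ∩ I⁻(θ₁ x)`
  have hUo : ∀ x : M, IsOpen (g.chronologicalFuture τ {θ (-1, x)} ∩
      g.chronologicalPast τ {θ (1, x)}) := fun x ↦
    (g.isOpen_chronologicalFuture_of_boundaryless τ _).inter
      (g.isOpen_chronologicalPast_of_boundaryless τ _)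
  have hUx : ∀ x : M, x ∈ g.chronologicalFuture τ {θ (-1, x)} ∩
      g.chronologicalPast τ {θ (1, x)} := by
    intro x
    constructor
    · have := h.flow_mem_chronologicalFuture hθX (show (-1 : ℝ) < 0 by norm_num) x
      rwa [hθ0] at this
    · apply mem_chronologicalPast_of_mem_chronologicalFuture
      have := h.flow_mem_chronologicalFuture hθX (show (0 : ℝ) < 1 by norm_num) x
      rwa [hθ0] at this
  set U : Set M := g.chronologicalFuture τ {θ (-1, p)} ∩ g.chronologicalPast τ {θ (1, p)} with hU
  set V : Set M := g.chronologicalFuture τ {θ (-1, q)} ∩ g.chronologicalPast τ {θ (1, q)} with hV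
  have hUV : U ×ˢ V ∈ 𝓝 (p, q) :=
    prod_mem_nhds ((hUo p).mem_nhds (hUx p)) ((hUo q).mem_nhds (hUx q))
  -- one realisation `(p₁, θ (t₁, p₁))` in `U × V`
  obtain ⟨⟨p₁, q₁⟩, ⟨hp₁U, hq₁V⟩, t₁, ht₁⟩ := mem_closure_iff_nhds.1 hpq _ hUV
  dsimp only at ht₁
  subst ht₁
  -- every realisation in `U × V` has its time in `K`
  have hK : ∀ {p₂ : M} {t₂ : ℝ}, p₂ ∈ U → θ (t₂, p₂) ∈ V → t₂ ∈ Icc (t₁ - 4) (t₁ + 4) := by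
    intro p₂ t₂ hp₂ hq₂
    constructor
    · have := h.sub_le_four hchr hθ hθ0 hθadd hθX
        (mem_chronologicalFuture_of_mem_chronologicalPast hp₂.2) hq₂.1 hp₁U.1
        (mem_chronologicalFuture_of_mem_chronologicalPast hq₁V.2)
      linarith
    · have := h.sub_le_four hchr hθ hθ0 hθadd hθX
        (mem_chronologicalFuture_of_mem_chronologicalPast hp₁U.2) hq₁V.1 hp₂.1
        (mem_chronologicalFuture_of_mem_chronologicalPast hq₂.2)
      linarith
  -- the relation with times in the compact `K` is closed
  set K : Set ℝ := Icc (t₁ - 4) (t₁ + 4) with hKdef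
  haveI : CompactSpace K := isCompact_iff_compactSpace.mp isCompact_Icc
  set G : Set (K × (M × M)) := {z | θ ((z.1 : ℝ), z.2.1) = z.2.2} with hG
  have hGc : IsClosed G := by
    refine isClosed_eq ?_ (continuous_snd.comp continuous_snd)
    exact hθ.continuous.comp
      ((continuous_subtype_val.comp continuous_fst).prodMk (continuous_fst.comp continuous_snd))
  set S : Set (M × M) := Prod.snd '' G with hS
  have hSc : IsClosed S := isClosedMap_snd_of_compactSpace G hGc
  have hSR : S ⊆ R := by
    rintro _ ⟨⟨t, ⟨x, y⟩⟩, hz, rfl⟩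
    exact ⟨(t : ℝ), hz⟩
  -- `(p, q)` is in the closure of `S`
  have hmem : (p, q) ∈ closure S := by
    rw [mem_closure_iff_nhds]
    intro W hW
    obtain ⟨⟨p₂, q₂⟩, ⟨hW₂, hp₂U, hq₂V⟩, t₂, ht₂⟩ :=
      mem_closure_iff_nhds.1 hpq _ (inter_mem hW hUV)
    dsimp only at ht₂
    subst ht₂
    exact ⟨(p₂, θ (t₂, p₂)), hW₂, ⟨(⟨t₂, hK hp₂U hq₂V⟩, (p₂, θ (t₂, p₂))), rfl, rfl⟩⟩
  rw [hSc.closure_eq] at hmem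
  exact hSR hmem

/-- **The orbit relation of a chronological stationary space-time is closed**: for a `C^n` metric,
`n ≥ 2`, on a Hausdorff manifold without boundary, a complete Killing field `X` timelike and
future-directed everywhere, and the chronology condition, the set of pairs `(p, q)` with `q` on the
orbit of `p` is closed in `M × M` (obtain the flow from
`Literature.Geometry.Manifold.exists_contMDiff_globalFlow_of_complete` and apply
`isClosed_setOf_exists_flow_eq`). Anderson 2000, §0: "The chronology condition implies that `S` is
Hausdorff", citing [Ha]. [cite: Anderson2000, §0] -/
theorem IsStationaryKilling.isClosed_setOf_mem_stationaryOrbit (h : g.IsStationaryKilling τ X univ)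
    (hchr : g.IsChronological τ) (hn : 2 ≤ n) :
    IsClosed {pq : M × M | pq.2 ∈ stationaryOrbit X {pq.1}} := by
  have hX2 : ContMDiff I I.tangent (2 : ℕ∞) (fun x ↦ (⟨x, X x⟩ : TangentBundle I M)) :=
    h.isKillingField.contMDiff.of_le (by exact_mod_cast hn)
  have hc : ∀ x : M, ∃ γ : ℝ → M, γ 0 = x ∧ IsMIntegralCurve γ X := fun x ↦ by
    obtain ⟨γ, hγ, h0⟩ := h.isCompleteVectorField x
    exact ⟨γ, h0, hγ⟩
  obtain ⟨θ, hθ, hθ0, hθadd, hθX⟩ :=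
    Literature.Geometry.Manifold.exists_contMDiff_globalFlow_of_complete hX2
      (by exact_mod_cast one_le_two) hc
  have hθ' : ContMDiff (𝓘(ℝ, ℝ).prod I) I 2 θ := by exact_mod_cast hθ
  have heq : {pq : M × M | pq.2 ∈ stationaryOrbit X {pq.1}} =
      {pq : M × M | ∃ t : ℝ, θ (t, pq.1) = pq.2} := by
    ext pq
    exact mem_stationaryOrbit_singleton_iff_exists_flow_eq
      (hX2.of_le (by exact_mod_cast one_le_two)) hθX hθ0
  rw [heq]
  exact h.isClosed_setOf_exists_flow_eq hchr hθ' hθ0 hθadd hθX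

/-- **The orbit space of a chronological stationary space-time is Hausdorff**, stated in `M`
without forming the quotient: two points `p`, `q` on different orbits of the stationary Killing
field have **disjoint, open, flow-invariant** (saturated: `stationaryOrbit X U = U`)
neighbourhoods — i.e. the images of `U` and `V` separate `π p ≠ π q` in `S = M/G` with the quotient
topology. From the closedness of the orbit relation: a product neighbourhood `U₀ × V₀` of `(p, q)`
misses it, and the saturations `⋃ₜ θₜ(U₀)`, `⋃ₜ θₜ(V₀)` are open (`isOpen_iUnion_image_flow`) and
disjoint (group law). Anderson 2000, §0 ("The chronology condition implies that `S` is Hausdorff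
and paracompact, c.f. [Ha]"). [cite: Anderson2000, §0] -/
theorem IsStationaryKilling.exists_disjoint_saturated_nhds (h : g.IsStationaryKilling τ X univ)
    (hchr : g.IsChronological τ) (hn : 2 ≤ n) {p q : M} (hpq : q ∉ stationaryOrbit X {p}) :
    ∃ U V : Set M, IsOpen U ∧ IsOpen V ∧ p ∈ U ∧ q ∈ V ∧
      stationaryOrbit X U = U ∧ stationaryOrbit X V = V ∧ Disjoint U V := by
  have hX2 : ContMDiff I I.tangent (2 : ℕ∞) (fun x ↦ (⟨x, X x⟩ : TangentBundle I M)) :=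
    h.isKillingField.contMDiff.of_le (by exact_mod_cast hn)
  have hX1 : CMDiff 1 (T% X) := hX2.of_le (by exact_mod_cast one_le_two)
  have hc : ∀ x : M, ∃ γ : ℝ → M, γ 0 = x ∧ IsMIntegralCurve γ X := fun x ↦ by
    obtain ⟨γ, hγ, h0⟩ := h.isCompleteVectorField x
    exact ⟨γ, h0, hγ⟩
  obtain ⟨θ, hθ, hθ0, hθadd, hθX⟩ :=
    Literature.Geometry.Manifold.exists_contMDiff_globalFlow_of_complete hX2
      (by exact_mod_cast one_le_two) hc
  have hθ' : ContMDiff (𝓘(ℝ, ℝ).prod I) I 2 θ := by exact_mod_cast hθ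
  have hR := h.isClosed_setOf_exists_flow_eq hchr hθ' hθ0 hθadd hθX
  have hpqR : (p, q) ∈ {pq : M × M | ∃ t : ℝ, θ (t, pq.1) = pq.2}ᶜ := fun ht ↦
    hpq ((mem_stationaryOrbit_singleton_iff_exists_flow_eq hX1 hθX hθ0).2 ht)
  obtain ⟨U₀, hU₀, V₀, hV₀, hUV⟩ := mem_nhds_prod_iff.1 (hR.isOpen_compl.mem_nhds hpqR)
  obtain ⟨U₁, hU₁U₀, hU₁o, hpU₁⟩ := mem_nhds_iff.1 hU₀
  obtain ⟨V₁, hV₁V₀, hV₁o, hqV₁⟩ := mem_nhds_iff.1 hV₀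
  refine ⟨stationaryOrbit X U₁, stationaryOrbit X V₁, ?_, ?_, ?_, ?_,
    stationaryOrbit_stationaryOrbit hX1 hθX hθ0 hθadd U₁,
    stationaryOrbit_stationaryOrbit hX1 hθX hθ0 hθadd V₁, ?_⟩
  · rw [stationaryOrbit_eq_iUnion_image_flow hX1 hθX hθ0]
    exact isOpen_iUnion_image_flow hθ'.continuous hθ0 hθadd hU₁o
  · rw [stationaryOrbit_eq_iUnion_image_flow hX1 hθX hθ0]
    exact isOpen_iUnion_image_flow hθ'.continuous hθ0 hθadd hV₁o
  · exact subset_stationaryOrbit (fun x ↦ ⟨fun t ↦ θ (t, x), hθX x, hθ0 x⟩) _ hpU₁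
  · exact subset_stationaryOrbit (fun x ↦ ⟨fun t ↦ θ (t, x), hθX x, hθ0 x⟩) _ hqV₁
  · rw [stationaryOrbit_eq_iUnion_image_flow hX1 hθX hθ0,
      stationaryOrbit_eq_iUnion_image_flow hX1 hθX hθ0, Set.disjoint_left]
    rintro y ⟨_, ⟨t, rfl⟩, u, hu, rfl⟩ ⟨_, ⟨s, rfl⟩, v, hv, hvy⟩
    -- `θ (s, v) = θ (t, u)` with `u ∈ U₁`, `v ∈ V₁`: then `v = θ (-s + t, u)`, so `(u, v) ∈ R`
    have hvy' : θ (s, v) = θ (t, u) := hvy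
    refine hUV (mk_mem_prod (hU₁U₀ hu) (hV₁V₀ hv)) ⟨-s + t, ?_⟩
    change θ (-s + t, u) = v
    rw [← hθadd, ← hvy', hθadd, neg_add_cancel, hθ0]

end LorentzianMetric

/-! ### The bundled form: Anderson's hypotheses -/

namespace Spacetime

variable {𝓢 : Spacetime.{u} 4} [𝓢.metric.HasLeviCivita]
  {X : Π x : 𝓢.carrier, TangentSpace (𝓡 4) x}

/-- **Anderson 2000, §0, for a bundled spacetime: the orbit relation is closed.** Under the
hypotheses of `Anderson2000_completeStationaryVacuumFlat` that concern the group action — a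
four-dimensional chronological spacetime with a complete Killing field timelike at every point —
the relation "`q` lies on the `G`-orbit of `p`" is closed in `M × M` ("The chronology condition
implies that `S` is Hausdorff", Anderson 2000, §0). [cite: Anderson2000, §0] -/
theorem IsStationaryKilling.isClosed_setOf_mem_stationaryOrbit (hX : 𝓢.IsStationaryKilling X univ)
    (hchr : 𝓢.metric.IsChronological 𝓢.timeOrientation) :
    IsClosed {pq : 𝓢.carrier × 𝓢.carrier | pq.2 ∈ 𝓢.stationaryOrbit X {pq.1}} :=
  LorentzianMetric.IsStationaryKilling.isClosed_setOf_mem_stationaryOrbit hX hchr ENat.LEInfty.out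

/-- **Anderson 2000, §0, for a bundled spacetime: the orbit space is Hausdorff** (separation of
distinct orbits by disjoint open flow-invariant sets). [cite: Anderson2000, §0] -/
theorem IsStationaryKilling.exists_disjoint_saturated_nhds (hX : 𝓢.IsStationaryKilling X univ)
    (hchr : 𝓢.metric.IsChronological 𝓢.timeOrientation) {p q : 𝓢.carrier}
    (hpq : q ∉ 𝓢.stationaryOrbit X {p}) :
    ∃ U V : Set 𝓢.carrier, IsOpen U ∧ IsOpen V ∧ p ∈ U ∧ q ∈ V ∧
      𝓢.stationaryOrbit X U = U ∧ 𝓢.stationaryOrbit X V = V ∧ Disjoint U V :=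
  LorentzianMetric.IsStationaryKilling.exists_disjoint_saturated_nhds hX hchr ENat.LEInfty.out hpq

end Spacetime

/-! ### No early returns: small neighbourhoods are revisited only after short times

Consequence of time rigidity used to cut local slices of the flow (Anderson 2000, §0: `π : M → S`
is a principal `ℝ`-bundle, i.e. locally trivial; the slices are local sections): every point `p`
has, for each `ε > 0`, a neighbourhood `N` such that an orbit segment starting and ending in `N` has
length `< ε` in flow time. -/

namespace LorentzianMetric

variable [FiniteDimensional ℝ E] [CompleteSpace E] [Fact (1 ≤ n)] [I.Boundaryless] [T2Space M]
  {g : LorentzianMetric I n M} [g.HasLeviCivita] {τ : TimeOrientation g}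
  {X : Π x : M, TangentSpace I x} {θ : ℝ × M → M}

omit [T2Space M] in
/-- **Returns to `U(p) = I⁺(θ₋₁ p) ∩ I⁻(θ₁ p)` happen only at times `|t| ≤ 4`**: if `x ∈ U(p)` and
`θ(t, x) ∈ U(p)` then `|t| ≤ 4` (time rigidity `sub_le_four` against the trivial realisation
`(p, 0)`). Anderson 2000, §0 (local triviality of `π : M → S`), from the chronology condition.
[cite: Anderson2000, §0] -/
theorem IsStationaryKilling.abs_le_four_of_flow_mem (h : g.IsStationaryKilling τ X univ)
    (hchr : g.IsChronological τ) (hθ : ContMDiff (𝓘(ℝ, ℝ).prod I) I 2 θ)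
    (hθ0 : ∀ p, θ (0, p) = p) (hθadd : ∀ t s p, θ (t, θ (s, p)) = θ (t + s, p))
    (hθX : ∀ p, IsMIntegralCurve (fun t ↦ θ (t, p)) X) {p x : M} {t : ℝ}
    (hx : x ∈ g.chronologicalFuture τ {θ (-1, p)} ∩ g.chronologicalPast τ {θ (1, p)})
    (hxt : θ (t, x) ∈ g.chronologicalFuture τ {θ (-1, p)} ∩ g.chronologicalPast τ {θ (1, p)}) :
    |t| ≤ 4 := by
  have hp₁ : θ (1, p) ∈ g.chronologicalFuture τ {p} := by
    have := h.flow_mem_chronologicalFuture hθX (show (0 : ℝ) < 1 by norm_num) p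
    rwa [hθ0] at this
  have hp₂ : p ∈ g.chronologicalFuture τ {θ (-1, p)} := by
    have := h.flow_mem_chronologicalFuture hθX (show (-1 : ℝ) < 0 by norm_num) p
    rwa [hθ0] at this
  have hp₁' : θ (0, p) ∈ g.chronologicalFuture τ {θ (-1, p)} := by rwa [hθ0]
  have hp₂' : θ (1, p) ∈ g.chronologicalFuture τ {θ (0, p)} := by rwa [hθ0]
  -- realisations `(p, 0)` and `(x, t)` in both orders
  have h1 : t - 0 ≤ 4 := h.sub_le_four hchr hθ hθ0 hθadd hθX hp₁ hp₁' hx.1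
    (mem_chronologicalFuture_of_mem_chronologicalPast hxt.2)
  have h2 : 0 - t ≤ 4 := h.sub_le_four hchr hθ hθ0 hθadd hθX
    (mem_chronologicalFuture_of_mem_chronologicalPast hx.2) hxt.1 hp₂ hp₂'
  rw [abs_le]
  constructor <;> linarith

/-- **No early returns.** Let `(M, g, τ)` be chronological (Hausdorff, without boundary) with a
stationary Killing field timelike at every point and flow `θ`. For every point `p` and `ε > 0`
there is an open neighbourhood `N` of `p` such that `x ∈ N`, `θ(t, x) ∈ N` force `|t| < ε`: an orbit
cannot leave a small neighbourhood and come back after a time `≥ ε`. Proof: returns near `p` have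
`|t| ≤ 4` (`abs_le_four_of_flow_mem`); the compact piece of orbit `θ(K × {p})`,
`K = {ε ≤ |t| ≤ 4}`, misses `p` (the orbit of `p` is injective, `injective_of_isChronological`),
so it is separated from `p` by disjoint open sets `O ∋ p`, `O' ⊇ θ(K × {p})`, and by the tube lemma
`θ(K × N₁) ⊆ O'` for a neighbourhood `N₁` of `p`; take `N = O ∩ N₁ ∩ U(p)`. This is the local
triviality of the orbit-space projection `π : M → S` ("a principle `ℝ`-bundle", Anderson 2000,
§0) at the level of flow times. [cite: Anderson2000, §0] -/
theorem IsStationaryKilling.exists_nhds_abs_lt_of_flow_mem (h : g.IsStationaryKilling τ X univ)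
    (hchr : g.IsChronological τ) (hθ : ContMDiff (𝓘(ℝ, ℝ).prod I) I 2 θ)
    (hθ0 : ∀ p, θ (0, p) = p) (hθadd : ∀ t s p, θ (t, θ (s, p)) = θ (t + s, p))
    (hθX : ∀ p, IsMIntegralCurve (fun t ↦ θ (t, p)) X) (p : M) {ε : ℝ} (hε : 0 < ε) :
    ∃ N : Set M, IsOpen N ∧ p ∈ N ∧ ∀ x ∈ N, ∀ t : ℝ, θ (t, x) ∈ N → |t| < ε := by
  -- the neighbourhood `U(p)`
  set U : Set M := g.chronologicalFuture τ {θ (-1, p)} ∩ g.chronologicalPast τ {θ (1, p)} with hU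
  have hUo : IsOpen U := (g.isOpen_chronologicalFuture_of_boundaryless τ _).inter
    (g.isOpen_chronologicalPast_of_boundaryless τ _)
  have hpU : p ∈ U := by
    constructor
    · have := h.flow_mem_chronologicalFuture hθX (show (-1 : ℝ) < 0 by norm_num) p
      rwa [hθ0] at this
    · apply mem_chronologicalPast_of_mem_chronologicalFuture
      have := h.flow_mem_chronologicalFuture hθX (show (0 : ℝ) < 1 by norm_num) p
      rwa [hθ0] at this
  -- the compact set of intermediate times and the corresponding piece of the orbit of `p`
  set K : Set ℝ := {t | ε ≤ |t| ∧ |t| ≤ 4} with hK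
  have hKc : IsCompact K := by
    refine isCompact_Icc.of_isClosed_subset ?_ (fun t ht ↦ abs_le.1 ht.2)
    exact (isClosed_le continuous_const continuous_abs).inter
      (isClosed_le continuous_abs continuous_const)
  have hθc : Continuous θ := hθ.continuous
  have hF : IsCompact (θ '' (K ×ˢ {p})) := (hKc.prod isCompact_singleton).image hθc
  have hpF : Disjoint ({p} : Set M) (θ '' (K ×ˢ {p})) := by
    rw [disjoint_singleton_left]
    rintro ⟨⟨t, p'⟩, hz, hpt⟩
    simp only [mem_prod, mem_singleton_iff] at hz
    obtain ⟨htK, hp'⟩ := hz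
    rw [hp'] at hpt
    have ht0 : t = 0 :=
      h.injective_of_isChronological hchr (hθX p) (hpt.trans (hθ0 p).symm)
    rw [ht0] at htK
    have h0 : ε ≤ |(0 : ℝ)| := htK.1
    rw [abs_zero] at h0
    linarith
  obtain ⟨O, O', hO, hO', hpO, hFO', hOO'⟩ :=
    SeparatedNhds.of_isCompact_isCompact isCompact_singleton hF hpF
  -- tube lemma: `θ (K × N₁) ⊆ O'`
  have hsub : K ×ˢ ({p} : Set M) ⊆ θ ⁻¹' O' := fun z hz ↦ hFO' (mem_image_of_mem θ hz)
  obtain ⟨K', N₁, -, hN₁, hKK', hpN₁, hKN⟩ :=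
    generalized_tube_lemma hKc isCompact_singleton (hO'.preimage hθc) hsub
  refine ⟨O ∩ N₁ ∩ U, (hO.inter hN₁).inter hUo,
    ⟨⟨hpO rfl, hpN₁ rfl⟩, hpU⟩, fun x hx t hxt ↦ ?_⟩
  have h4 : |t| ≤ 4 := h.abs_le_four_of_flow_mem hchr hθ hθ0 hθadd hθX hx.2 hxt.2
  by_contra hlt
  have htK : t ∈ K := ⟨le_of_not_gt hlt, h4⟩
  have hO'mem : θ (t, x) ∈ O' := hKN (mk_mem_prod (hKK' htK) hx.1.2)
  exact Set.disjoint_left.1 hOO' hxt.1.1 hO'mem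

end LorentzianMetric

end Literature.Geometry.Lorentzian

end
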